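import Summits.AtomisticToContinuum.FouriersLaw.Theses.HoelderEscapeProfile
import Summits.AtomisticToContinuum.FouriersLaw.Theorems.HoelderEscapeProfileFibreCalculusStubStaticStructureFactor
import Summits.AtomisticToContinuum.FouriersLaw.Theorems.HoelderEscapeProfileFibreCalculusStubPolynomialHorizonCone
import Summits.AtomisticToContinuum.FouriersLaw.Theorems.HoelderEscapeProfileFibreCalculusStubWeightedClusteringTransfer
import Summits.AtomisticToContinuum.FouriersLaw.Theorems.HoelderEscapeProfileFibreCalculusStubTwiceIntegratedContinuity
import Summits.AtomisticToContinuum.FouriersLaw.Theorems.HoelderEscapeProfileFibreCalculusStubBochnerPositivity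
import Summits.AtomisticToContinuum.FouriersLaw.Theorems.HoelderEscapeProfileFibreCalculusStubConservationLawIdentities
import Summits.AtomisticToContinuum.FouriersLaw.Theorems.CageBudgetFeketeHeatVarianceCalculus
import Summits.AtomisticToContinuum.FouriersLaw.Theorems.EmbeddedDrudeMourreMourreDissolutionGibbsMixing
import Literature.Analysis.Fourier.CosineSeriesOrthogonality
import Literature.Analysis.Asymptotics.LaplaceWindowBounds
import Literature.MathematicalPhysics.KineticTheory.TransportRegularityOfMixing
import Literature.MathematicalPhysics.KineticTheory.InfiniteChainClusteringTransfer
import Literature.MathematicalPhysics.KineticTheory.InfiniteChainGeneratorLipschitz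
import Literature.MathematicalPhysics.KineticTheory.InfiniteChainTwoPointContinuity
import Literature.MathematicalPhysics.KineticTheory.InfiniteChainCorrelationContinuity
import Literature.MathematicalPhysics.KineticTheory.InfiniteChainCurrentMoments
import Literature.MathematicalPhysics.KineticTheory.InfiniteChainEnergyDensityMoments
import Literature.MathematicalPhysics.KineticTheory.InfiniteChainPartialMomentumReversal
import Literature.MathematicalPhysics.KineticTheory.InfiniteChainGibbsInvariance
import Literature.MathematicalPhysics.KineticTheory.InfiniteChainShiftInvariantUniqueness
import HarnessLib

/-!
# `HoelderEscapeProfile.FibreCalculus` — PROVED (item stmt-AtomisticToContinuum-16011, line `Sketch`)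

The twelve-clause infinite-volume fibre calculus of the Abel escape profile for EVERY guarded arena `(μ, D)` of the
pinned anharmonic chain. Architecture (canonical reduction): RIGIDITY (`flow_ae_eq_canonical`: the guarded `D` is the
canonical Buttà–Marchioro dynamics `D♭` a.e. at all times, so `S`, `G`, `C_T` of `D` are those of `D♭`); six landed
stubs — statics (`stub_staticStructureFactor`), the polynomial-horizon weighted `L²` light cone
(`stub_polynomialHorizonCone`), the weighted clustering transfer (`stub_weightedClusteringTransfer`), the
twice-integrated local conservation law (`stub_twiceIntegratedContinuity`), Bochner positivity
(`stub_bochnerPositivity`), the Abel identities (`stub_conservationLawIdentities`); plumbing here: `μ` IS the ρ-mixing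
transfer-operator state (DLR uniqueness), `S = Cov(h₀,(h₀∘φ_t)∘τ_x)`, `G = Cov(j₀,(j₀∘φ_t)∘τ_x)`, window majorants
with `Σ_x (1+x²)(|S|+|G|) ≤ A(1+|t|)^m` ⇒ clauses (1)(2)(3)(4)(10); (7) = (11) at `k = 0`; (9) = Parseval at zero.
[cite: ButtaMarchioro2016, §2 Thm 2.1 and §3] [cite: BonettoLebowitzReyBellet2000, §7 eq. (37)] [cite: Helfand1960]
-/

noncomputable section

open MeasureTheory ProbabilityTheory Filter Topology Set Function

namespace Summit.AtomisticToContinuum.FouriersLaw.Theorems.FibreCalculusSketch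

open Literature.MathematicalPhysics.KineticTheory.HeatConduction
open Literature.Analysis.Asymptotics Literature.Analysis.Fourier

/-- **The route item `HoelderEscapeProfile.FibreCalculus`, proved** (closes stmt-AtomisticToContinuum-16011) by the
canonical reduction: rigidity, the six stubs of line `Sketch`, and the Abel/clustering plumbing. -/
theorem fibreCalculus_proof : Summit.AtomisticToContinuum.FouriersLaw.Theses.HoelderEscapeProfile.FibreCalculus := by
  intro ω₂ lam β γ hω hl hβ T hT μ hG hSI hRefl D hP _hShift h hh S hS Sb hSb G hGd Gh hGh fh hfh χk hχk
  /- §0 chain data, superstability, the canonical dynamics, rigidity -/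
  have hss : (pinnedChain ω₂ lam β γ).HasSuperstabilityEstimate μ :=
    OscillatorChain.hasSuperstabilityEstimate_of_isShiftInvariant_pinnedChain γ hω hl.le hβ.le hT hG hSI
  haveI : IsProbabilityMeasure μ := hss.1
  have hU0 : ∀ q : ℝ, 0 ≤ (pinnedChain ω₂ lam β γ).U q := OscillatorChain.pinnedChain_U_nonneg β γ hω.le hl.le
  have hV0 : ∀ r : ℝ, 0 ≤ (pinnedChain ω₂ lam β γ).V r := OscillatorChain.pinnedChain_V_nonneg ω₂ lam γ hβ.le
  have hUm : Measurable (pinnedChain ω₂ lam β γ).U := OscillatorChain.measurable_pinnedChain_U ω₂ lam β γ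
  have hVm : Measurable (pinnedChain ω₂ lam β γ).V := OscillatorChain.measurable_pinnedChain_V ω₂ lam β γ
  have hU2 : OscillatorChain.IsEvenPolyOfDegree (pinnedChain ω₂ lam β γ).U 2 :=
    OscillatorChain.pinnedChain_isEvenPolyOfDegree_U β γ hω.le hl
  have hV2 : OscillatorChain.IsEvenPolyOfDegree (pinnedChain ω₂ lam β γ).V 2 :=
    OscillatorChain.pinnedChain_isEvenPolyOfDegree_V ω₂ lam γ hβ
  obtain ⟨D', hcar, hmeas, hid, -, -, -, hpresAll⟩ :=
    OscillatorChain.exists_bmDynamics (P := pinnedChain ω₂ lam β γ) one_le_two one_le_two hU2 hV2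
  have hP' : D'.PreservesMeasure μ := hpresAll T μ hG hss
  have hrig := HeatVarianceCalculus.CanonicalRigidity.flow_ae_eq_canonical γ hω hl hβ hT hG hSI D D' hP hcar
  have hφ : ∀ (t : ℝ) (x : ℤ) (σ : ChainConfig), D'.flow t (chainShift x σ) = chainShift x (D'.flow t σ) :=
    fun t x σ => D'.flow_chainShift_of_eq_id hcar hid hU0 hV0 t x σ
  have hτ : ∀ x : ℤ, MeasurePreserving (chainShift x) μ μ := hSI.measurePreserving_chainShift
  /- §1 the objects of `D` are the objects of `D♭` -/
  have hh' : ∀ (σ : ChainConfig) (x : ℤ), h σ x = (pinnedChain ω₂ lam β γ).energyDensityZ σ x := by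
    intro σ x; subst hh; rfl
  have hS' : S = fun (x : ℤ) (t : ℝ) =>
      ∫ σ, (h σ 0 - ∫ σ', h σ' 0 ∂μ) * (h (D'.flow t σ) x - ∫ σ', h σ' 0 ∂μ) ∂μ := by
    subst hS
    funext x t
    refine integral_congr_ae ?_
    filter_upwards [hrig] with σ hσ
    rw [hσ t]
  have hG' : G = fun (x : ℤ) (t : ℝ) => ∫ σ, (pinnedChain ω₂ lam β γ).bondCurrentZ σ 0 *
      (pinnedChain ω₂ lam β γ).bondCurrentZ (D'.flow t σ) x ∂μ := by
    subst hGd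
    funext x t
    refine integral_congr_ae ?_
    filter_upwards [hrig] with σ hσ
    rw [hσ t]
  have hCG : ∀ t : ℝ, D.currentCorrelation μ t = ∑' x : ℤ, G x t := by
    intro t; subst hGd; rfl
  /- §2 the ρ-mixing transfer-operator state: `μ` IS it (DLR uniqueness among shift-invariant states) -/
  obtain ⟨μ', hGμ', hSμ', -, -, C, mm, hmm, hmix⟩ :=
    Summit.AtomisticToContinuum.FouriersLaw.Theorems.MourreDissolution.exists_gibbsState_mixing_pinnedChain
      ω₂ lam β γ hω hl.le hβ.le T hT
  have hμμ' : μ = μ' :=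
    OscillatorChain.eq_of_isChainGibbsMeasure_of_isShiftInvariant_pinnedChain γ hω hl.le hβ.le hT hG hSI hGμ' hSμ'
  subst hμμ'
  /- §3 the two generators `h₀`, `j₀` -/
  set h0 : ChainConfig → ℝ := fun σ => (pinnedChain ω₂ lam β γ).energyDensityZ σ 0 with h0def
  set j0 : ChainConfig → ℝ := fun σ => (pinnedChain ω₂ lam β γ).bondCurrentZ σ 0 with j0def
  have h0m : Measurable h0 := (pinnedChain ω₂ lam β γ).measurable_energyDensityZ hUm hVm 0
  have j0m : Measurable j0 := measurable_bondCurrentZ _ 0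
  have h0d : DependsOn h0 (Set.Icc (-1 : ℤ) 1) := OscillatorChain.dependsOn_energyDensityZ_zero _
  have j0d : DependsOn j0 (Set.Icc (-1 : ℤ) 1) := OscillatorChain.dependsOn_bondCurrentZ_zero _
  have h02 : MemLp h0 2 μ := hss.memLp_energyDensityZ hU0 hV0 hUm hVm 0 ENNReal.ofNat_ne_top
  have j02 : MemLp j0 2 μ := hss.memLp_bondCurrentZ one_le_two hU0 hUm hV2 0 ENNReal.ofNat_ne_top
  have h04 : Integrable (fun σ => h0 σ ^ 4) μ := hss.integrable_energyDensityZ_pow_four hU0 hV0 hUm hVm 0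
  have j04 : Integrable (fun σ => j0 σ ^ 4) μ := hss.integrable_bondCurrentZ_pow_four one_le_two hU0 hUm hV2 0
  obtain ⟨Ch, hCh, hLh⟩ := OscillatorChain.exists_polyLipschitz_energyDensityZ hU2 hV2
  obtain ⟨Cj, hCj, hLj⟩ := OscillatorChain.exists_polyLipschitz_bondCurrentZ (P := pinnedChain ω₂ lam β γ) hV2
  /- §4 W1: polynomial-horizon cones for `h₀`, `j₀` -/
  obtain ⟨Ah, mh, hconeH⟩ := stub_polynomialHorizonCone ω₂ lam β γ hω hl hβ T hT μ hG hSI D' hcar hmeas h0 h0m h0d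
    h02 h04 Ch (2 * 2 + 2 * 2 + 1) hCh hLh
  obtain ⟨Aj, mj, hconeJ⟩ := stub_polynomialHorizonCone ω₂ lam β γ hω hl hβ T hT μ hG hSI D' hcar hmeas j0 j0m j0d
    j02 j04 Cj (2 * 2 + 1) hCj hLj
  /- §5 W2: weighted clustering transfer for `h₀`, `j₀` -/
  have h0d' : DependsOn h0 (Set.Icc (-((1 : ℕ) : ℤ)) (1 : ℕ)) := by simpa using h0d
  have j0d' : DependsOn j0 (Set.Icc (-((1 : ℕ) : ℤ)) (1 : ℕ)) := by simpa using j0d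
  obtain ⟨Bh, hBh⟩ := stub_weightedClusteringTransfer μ inferInstance C mm hmm hmix hτ h0 1 h0d' h0m h02 1
    (Real.sqrt (∫ σ, h0 σ ^ 2 ∂μ)) (Real.sqrt_nonneg _)
  obtain ⟨Bj, hBj⟩ := stub_weightedClusteringTransfer μ inferInstance C mm hmm hmix hτ j0 1 j0d' j0m j02 1
    (Real.sqrt (∫ σ, j0 σ ^ 2 ∂μ)) (Real.sqrt_nonneg _)
  /- §6 `S`, `G` as translated covariances -/
  have hmeanH : ∀ (t : ℝ) (x : ℤ), ∫ σ, ((h0 ∘ D'.flow t) ∘ chainShift x) σ ∂μ = ∫ σ, h0 σ ∂μ := by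
    intro t x
    have e1 : ∫ σ, ((h0 ∘ D'.flow t) ∘ chainShift x) σ ∂μ = ∫ σ, (h0 ∘ D'.flow t) σ ∂μ :=
      integral_comp_eq_of_measurePreserving (hτ x) (h0m.comp (hmeas t))
    rw [e1]
    exact integral_comp_eq_of_measurePreserving (hP'.2 t) h0m
  have hScov : ∀ (x : ℤ) (t : ℝ), S x t = cov[h0, (h0 ∘ D'.flow t) ∘ chainShift x; μ] := by
    intro x t
    rw [hS']
    simp only [covariance, hmeanH t x]
    refine integral_congr_ae (Eventually.of_forall fun σ => ?_)
    simp only [comp_apply, hφ t x σ, h0def, hh', OscillatorChain.energyDensityZ_chainShift, zero_add]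
  have hmeanJ : ∫ σ, j0 σ ∂μ = 0 := hG.integral_bondCurrentZ_eq_zero 0
  have hGcov : ∀ (x : ℤ) (t : ℝ), G x t = cov[j0, (j0 ∘ D'.flow t) ∘ chainShift x; μ] := by
    intro x t
    have hY2 : MemLp ((j0 ∘ D'.flow t) ∘ chainShift x) 2 μ :=
      (j02.comp_measurePreserving (hP'.2 t)).comp_measurePreserving (hτ x)
    rw [covariance_eq_sub j02 hY2, hmeanJ, zero_mul, sub_zero, hG']
    refine integral_congr_ae (Eventually.of_forall fun σ => ?_)
    simp only [Pi.mul_apply, comp_apply, hφ t x σ, j0def, OscillatorChain.bondCurrentZ_chainShift, zero_add]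
  /- §7 window majorants with polynomial weighted sums -/
  have hIcc : ∀ n : ℕ, Set.Icc (-((n + 1 : ℕ) : ℤ)) ((n + 1 : ℕ) : ℤ) = Set.Icc (-(n : ℤ) - 1) ((n : ℤ) + 1) := by
    intro n; push_cast; ring_nf
  have hwin : ∀ (a : ChainConfig → ℝ) (ham : Measurable a) (ha2 : MemLp a 2 μ) (A : ℝ) (m : ℕ) (B : ℝ),
      (∀ τ : ℝ, 0 ≤ τ → ∃ ε : ℕ → ℝ, (∀ n, 0 ≤ ε n) ∧
        Summable (fun n : ℕ => (1 + (n : ℝ)) ^ 2 * ε n) ∧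
        (∑' n : ℕ, (1 + (n : ℝ)) ^ 2 * ε n) ≤ A * (1 + τ) ^ m ∧
        ∀ t : ℝ, |t| ≤ τ → ∀ n : ℕ, ∃ g : ChainConfig → ℝ,
          DependsOn g (Set.Icc (-(n : ℤ) - 1) (n + 1)) ∧ Measurable g ∧ MemLp g 2 μ ∧
          Real.sqrt (∫ σ, (a (D'.flow t σ) - g σ) ^ 2 ∂μ) ≤ ε n) →
      (∀ ε : ℕ → ℝ, (∀ n, 0 ≤ ε n) → Summable (fun n : ℕ => (1 + (n : ℝ)) ^ 2 * ε n) →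
        ∃ F : ℤ → ℝ, Summable (fun x : ℤ => (1 + (x : ℝ) ^ 2) * F x) ∧
          (∑' x : ℤ, (1 + (x : ℝ) ^ 2) * F x) ≤ B * (1 + ∑' n : ℕ, (1 + (n : ℝ)) ^ 2 * ε n) ∧
          ∀ g : ChainConfig → ℝ, Measurable g → MemLp g 2 μ →
            Real.sqrt (∫ σ, g σ ^ 2 ∂μ) ≤ Real.sqrt (∫ σ, a σ ^ 2 ∂μ) →
            (∀ n : ℕ, ∃ h : ChainConfig → ℝ, DependsOn h (Set.Icc (-((n + 1 : ℕ) : ℤ)) (n + 1 : ℕ)) ∧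
              Measurable h ∧ MemLp h 2 μ ∧ Real.sqrt (∫ σ, (g σ - h σ) ^ 2 ∂μ) ≤ ε n) →
            ∀ x : ℤ, |cov[a, g ∘ chainShift x; μ]| ≤ F x) →
      ∀ τ : ℝ, 0 ≤ τ → ∃ F : ℤ → ℝ, (∀ x, 0 ≤ F x) ∧ Summable (fun x : ℤ => (1 + (x : ℝ) ^ 2) * F x) ∧
        (∑' x : ℤ, (1 + (x : ℝ) ^ 2) * F x) ≤ |B| * (1 + A) * (1 + τ) ^ m ∧
        ∀ t : ℝ, |t| ≤ τ → ∀ x : ℤ, |cov[a, (a ∘ D'.flow t) ∘ chainShift x; μ]| ≤ F x := by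
    intro a ham ha2 A m B hcone htrans τ hτ0
    obtain ⟨ε, hε0, hεs, hεb, happ⟩ := hcone τ hτ0
    obtain ⟨F, hFs, hFb, hcov⟩ := htrans ε hε0 hεs
    have hbound : ∀ t : ℝ, |t| ≤ τ → ∀ x : ℤ, |cov[a, (a ∘ D'.flow t) ∘ chainShift x; μ]| ≤ F x := by
      intro t ht x
      refine hcov (a ∘ D'.flow t) (ham.comp (hmeas t)) (ha2.comp_measurePreserving (hP'.2 t)) ?_ ?_ x
      · exact (Real.sqrt_le_sqrt (integral_sq_comp_eq' (hP'.2 t) ham).le)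
      · intro n
        obtain ⟨g, hgd, hgm, hg2, hge⟩ := happ t ht n
        refine ⟨g, ?_, hgm, hg2, hge⟩
        rw [hIcc n]
        exact hgd
    have hF0 : ∀ x, 0 ≤ F x := fun x => (abs_nonneg _).trans (hbound 0 (by rw [abs_zero]; exact hτ0) x)
    have hE0 : 0 ≤ ∑' n : ℕ, (1 + (n : ℝ)) ^ 2 * ε n := tsum_nonneg fun n => mul_nonneg (by positivity) (hε0 n)
    have hA0 : 0 ≤ A * (1 + τ) ^ m := hE0.trans hεb
    refine ⟨F, hF0, hFs, hFb.trans ?_, hbound⟩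
    have h1τ : (1 : ℝ) ≤ (1 + τ) ^ m := one_le_pow₀ (by linarith)
    calc B * (1 + ∑' n : ℕ, (1 + (n : ℝ)) ^ 2 * ε n)
        ≤ |B| * (1 + ∑' n : ℕ, (1 + (n : ℝ)) ^ 2 * ε n) :=
          mul_le_mul_of_nonneg_right (le_abs_self B) (by linarith)
      _ ≤ |B| * (1 + A * (1 + τ) ^ m) := mul_le_mul_of_nonneg_left (by linarith) (abs_nonneg B)
      _ ≤ |B| * ((1 + A) * (1 + τ) ^ m) := by
          refine mul_le_mul_of_nonneg_left ?_ (abs_nonneg B)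
          nlinarith
      _ = |B| * (1 + A) * (1 + τ) ^ m := by ring
  have hwinS := hwin h0 h0m h02 Ah mh Bh hconeH hBh
  have hwinG := hwin j0 j0m j02 Aj mj Bj hconeJ hBj
  /- §8 pointwise-in-time consequences -/
  have hSt : ∀ t : ℝ, Summable (fun x : ℤ => (1 + (x : ℝ) ^ 2) * |S x t|) ∧
      (∑' x : ℤ, (1 + (x : ℝ) ^ 2) * |S x t|) ≤ |Bh| * (1 + Ah) * (1 + |t|) ^ mh := by
    intro t
    obtain ⟨F, hF0, hFs, hFb, hb⟩ := hwinS |t| (abs_nonneg t)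
    have hle : ∀ x : ℤ, (1 + (x : ℝ) ^ 2) * |S x t| ≤ (1 + (x : ℝ) ^ 2) * F x := fun x => by
      rw [hScov x t]
      exact mul_le_mul_of_nonneg_left (hb t le_rfl x) (by positivity)
    have hs : Summable (fun x : ℤ => (1 + (x : ℝ) ^ 2) * |S x t|) :=
      Summable.of_nonneg_of_le (fun x => by positivity) hle hFs
    exact ⟨hs, (hs.tsum_le_tsum hle hFs).trans hFb⟩
  have hGt : ∀ t : ℝ, Summable (fun x : ℤ => (1 + (x : ℝ) ^ 2) * |G x t|) ∧
      (∑' x : ℤ, (1 + (x : ℝ) ^ 2) * |G x t|) ≤ |Bj| * (1 + Aj) * (1 + |t|) ^ mj := by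
    intro t
    obtain ⟨F, hF0, hFs, hFb, hb⟩ := hwinG |t| (abs_nonneg t)
    have hle : ∀ x : ℤ, (1 + (x : ℝ) ^ 2) * |G x t| ≤ (1 + (x : ℝ) ^ 2) * F x := fun x => by
      rw [hGcov x t]
      exact mul_le_mul_of_nonneg_left (hb t le_rfl x) (by positivity)
    have hs : Summable (fun x : ℤ => (1 + (x : ℝ) ^ 2) * |G x t|) :=
      Summable.of_nonneg_of_le (fun x => by positivity) hle hFs
    exact ⟨hs, (hs.tsum_le_tsum hle hFs).trans hFb⟩
  -- window majorants of `G` without weight (for the M-test)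
  have hGmaj : ∀ τ : ℝ, 0 ≤ τ → ∃ m : ℤ → ℝ, Summable m ∧ ∀ t : ℝ, |t| ≤ τ → ∀ x : ℤ, |G x t| ≤ m x := by
    intro τ hτ0
    obtain ⟨F, hF0, hFs, -, hb⟩ := hwinG τ hτ0
    refine ⟨F, Summable.of_nonneg_of_le hF0 (fun x => ?_) hFs, fun t ht x => ?_⟩
    · exact le_mul_of_one_le_left (hF0 x) (by nlinarith [sq_nonneg (x : ℝ)])
    · rw [hGcov x t]; exact hb t ht x
  /- §9 continuity in time -/
  have hScont : ∀ x : ℤ, Continuous (S x) := by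
    intro x
    have hc := InfiniteChainDynamics.continuous_integral_energyDensityZ_mul_flow_pinnedChain γ hω.le hl.le hβ
      hss D' hP' x 0
    have e : S x = fun t : ℝ => (∫ σ, (pinnedChain ω₂ lam β γ).energyDensityZ σ 0 *
        (pinnedChain ω₂ lam β γ).energyDensityZ (D'.flow t σ) x ∂μ) - (∫ σ, h0 σ ∂μ) * ∫ σ, h0 σ ∂μ := by
      funext t
      have hY2 : MemLp ((h0 ∘ D'.flow t) ∘ chainShift x) 2 μ :=
        (h02.comp_measurePreserving (hP'.2 t)).comp_measurePreserving (hτ x)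
      rw [hScov x t, covariance_eq_sub h02 hY2, hmeanH t x]
      congr 1
      refine integral_congr_ae (Eventually.of_forall fun σ => ?_)
      simp only [Pi.mul_apply, comp_apply, hφ t x σ, h0def, OscillatorChain.energyDensityZ_chainShift, zero_add]
    rw [e]
    exact hc.sub continuous_const
  have hGcont : ∀ x : ℤ, Continuous (G x) := by
    intro x
    rw [hG']
    exact InfiniteChainDynamics.continuous_integral_bondCurrentZ_mul_flow_pinnedChain γ hω.le hl.le hβ hss D' hP' x 0
  have hCkcont : ∀ k : ℝ, Continuous fun t : ℝ => ∑' x : ℤ, Real.cos (k * (x : ℝ)) * G x t := by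
    intro k
    refine continuous_tsum_of_window_majorant (f := fun (x : ℤ) (t : ℝ) => Real.cos (k * (x : ℝ)) * G x t)
      (fun x => continuous_const.mul (hGcont x)) fun τ hτ0 => ?_
    obtain ⟨m, hm, hb⟩ := hGmaj τ hτ0
    refine ⟨m, hm, fun t ht x => ?_⟩
    rw [abs_mul]
    exact (mul_le_of_le_one_left (abs_nonneg _) (Real.abs_cos_le_one _)).trans (hb t ht x)
  /- §10 the clauses -/
  -- (3)
  have h3 : ∀ x : ℤ, ∀ ν : ℝ, 0 < ν → IntegrableOn (fun t : ℝ => Real.exp (-(ν * t)) * S x t) (Ioi 0) := by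
    intro x ν hν
    refine integrableOn_exp_neg_mul_of_abs_le_one_add_pow (hScont x) (K := |Bh| * (1 + Ah)) (n := mh) ?_ hν
    intro t ht
    have h := abs_le_of_weighted_tsum_le (hSt t).1 (hSt t).2 x
    rwa [abs_of_nonneg ht] at h
  -- (4)
  have h4 : ∀ ν : ℝ, 0 < ν → Summable (fun x : ℤ => (1 + (x : ℝ) ^ 2) * |Sb ν x|) := by
    intro ν hν
    set K : ℝ := |Bh| * (1 + Ah) with hK
    have hpoly : Continuous fun t : ℝ => K * (1 + t) ^ mh := by fun_prop
    have hmajI : IntegrableOn (fun t : ℝ => Real.exp (-(ν * t)) * (K * (1 + t) ^ mh)) (Ioi 0) :=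
      integrableOn_exp_neg_mul_of_abs_le_one_add_pow hpoly (K := |K|) (n := mh)
        (fun t ht => by rw [abs_mul, abs_of_nonneg (pow_nonneg (by linarith : (0:ℝ) ≤ 1 + t) mh)]) hν
    refine summable_of_sum_le (fun x => by positivity) (c := ν * ∫ t in Ioi (0:ℝ),
      Real.exp (-(ν * t)) * (K * (1 + t) ^ mh)) fun u => ?_
    have hterm : ∀ x ∈ u, (1 + (x : ℝ) ^ 2) * |Sb ν x| ≤
        ν * ∫ t in Ioi (0:ℝ), Real.exp (-(ν * t)) * ((1 + (x : ℝ) ^ 2) * |S x t|) := by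
      intro x _
      rw [hSb]
      dsimp only
      rw [abs_mul, abs_of_pos hν, mul_left_comm]
      refine mul_le_mul_of_nonneg_left ?_ hν.le
      have h1 : |∫ t in Ioi (0:ℝ), Real.exp (-(ν * t)) * S x t| ≤
          ∫ t in Ioi (0:ℝ), |Real.exp (-(ν * t)) * S x t| := abs_integral_le_integral_abs
      have h2 : ∫ t in Ioi (0:ℝ), |Real.exp (-(ν * t)) * S x t| =
          ∫ t in Ioi (0:ℝ), Real.exp (-(ν * t)) * |S x t| :=
        integral_congr_ae (Eventually.of_forall fun t => by
          simp only [abs_mul, abs_of_pos (Real.exp_pos _)])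
      calc (1 + (x : ℝ) ^ 2) * |∫ t in Ioi (0:ℝ), Real.exp (-(ν * t)) * S x t|
          ≤ (1 + (x : ℝ) ^ 2) * ∫ t in Ioi (0:ℝ), Real.exp (-(ν * t)) * |S x t| := by
            refine mul_le_mul_of_nonneg_left (h1.trans_eq h2) (by positivity)
        _ = ∫ t in Ioi (0:ℝ), (1 + (x : ℝ) ^ 2) * (Real.exp (-(ν * t)) * |S x t|) :=
            (integral_const_mul _ _).symm
        _ = ∫ t in Ioi (0:ℝ), Real.exp (-(ν * t)) * ((1 + (x : ℝ) ^ 2) * |S x t|) :=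
            integral_congr_ae (Eventually.of_forall fun t => by ring)
    have hint : ∀ x : ℤ, IntegrableOn (fun t : ℝ => Real.exp (-(ν * t)) * ((1 + (x : ℝ) ^ 2) * |S x t|))
        (Ioi 0) := by
      intro x
      have h := ((h3 x ν hν).norm).const_mul (1 + (x : ℝ) ^ 2)
      refine h.congr (Eventually.of_forall fun t => ?_)
      simp only [Real.norm_eq_abs, abs_mul, abs_of_pos (Real.exp_pos _)]
      ring
    calc ∑ x ∈ u, (1 + (x : ℝ) ^ 2) * |Sb ν x|
        ≤ ∑ x ∈ u, ν * ∫ t in Ioi (0:ℝ), Real.exp (-(ν * t)) * ((1 + (x : ℝ) ^ 2) * |S x t|) :=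
          Finset.sum_le_sum hterm
      _ = ν * ∫ t in Ioi (0:ℝ), Real.exp (-(ν * t)) * ∑ x ∈ u, (1 + (x : ℝ) ^ 2) * |S x t| := by
          rw [← Finset.mul_sum, ← integral_finsetSum u (fun x _ => hint x)]
          congr 1
          refine integral_congr_ae (Eventually.of_forall fun t => ?_)
          simp only [Finset.mul_sum]
      _ ≤ ν * ∫ t in Ioi (0:ℝ), Real.exp (-(ν * t)) * (K * (1 + t) ^ mh) := by
          refine mul_le_mul_of_nonneg_left ?_ hν.le
          refine setIntegral_mono_on (integrable_finsetSum u (fun x _ => hint x) |>.congr ?_) hmajI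
            measurableSet_Ioi fun t ht => ?_
          · exact Eventually.of_forall fun t => by simp only [Finset.mul_sum]
          · refine mul_le_mul_of_nonneg_left ?_ (Real.exp_pos _).le
            have hs := (hSt t).1
            calc ∑ x ∈ u, (1 + (x : ℝ) ^ 2) * |S x t| ≤ ∑' x : ℤ, (1 + (x : ℝ) ^ 2) * |S x t| :=
                  hs.sum_le_tsum u fun x _ => by positivity
              _ ≤ K * (1 + |t|) ^ mh := (hSt t).2
              _ = K * (1 + t) ^ mh := by rw [abs_of_pos (mem_Ioi.1 ht)]
  -- (5), (6): statics
  have hS0 : (fun x : ℤ => S x 0) =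
      (fun x : ℤ => ∫ σ, (h σ 0 - ∫ σ', h σ' 0 ∂μ) * (h σ x - ∫ σ', h σ' 0 ∂μ) ∂μ) := by
    funext x
    rw [hS]
    refine integral_congr_ae ?_
    filter_upwards [hP.1] with σ hσ
    rw [D.flow_zero σ hσ]
  obtain ⟨h5, h6⟩ := stub_staticStructureFactor ω₂ lam β γ hω hl hβ T hT μ hG hSI hRefl h hh (fun x : ℤ => S x 0) hS0
  have h5' : Summable (fun x : ℤ => (1 + (x : ℝ) ^ 2) * |S x 0|) := by simpa using h5
  have hχ0 : χk 0 = ∑' x : ℤ, S x 0 := by simp only [hχk, zero_mul, Real.cos_zero, one_mul]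
  have h6' : 0 < χk 0 := by rw [hχ0]; simpa using h6
  -- (8): Bochner
  have hSbabs : ∀ ν : ℝ, 0 < ν → Summable (fun x : ℤ => |Sb ν x|) := fun ν hν => summable_abs_of_weighted_summable (h4 ν hν)
  have h8 : ∀ ν : ℝ, 0 < ν → ∀ k : ℝ, 0 ≤ fh ν k :=
    stub_bochnerPositivity ω₂ lam β γ hω hl hβ T hT μ hG hSI hRefl D' hcar hmeas hid h hh S hS' Sb hSb h3 hSbabs fh hfh
  -- (11), (12): the identities (stub P feeds stub I)
  have hPid := stub_twiceIntegratedContinuity ω₂ lam β γ hω hl hβ T hT μ hG hSI hRefl D' hcar hmeas hid h hh S hS'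
    G hG'
  obtain ⟨MG, -, hMG⟩ := OscillatorChain.exists_abs_correlationTerm_le_pinnedChain γ hω.le hl.le hβ hss D' hP'
  have hMG' : ∃ M : ℝ, ∀ (x : ℤ) (t : ℝ), |G x t| ≤ M := ⟨MG, fun x t => by rw [hG']; exact hMG t x⟩
  obtain ⟨h11, h12'⟩ := stub_conservationLawIdentities S G hGcont hMG' ⟨|Bj| * (1 + Aj), mj, hGt⟩ hPid h3 Sb hSb h4 h5'
    Gh hGh fh hfh χk hχk
  -- (10)
  have h10 : ∀ ν : ℝ, 0 < ν → ∀ k : ℝ,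
      IntegrableOn (fun t : ℝ => Real.exp (-(ν * t)) * ∑' x : ℤ, Real.cos (k * (x : ℝ)) * G x t) (Ioi 0) := by
    intro ν hν k
    refine integrableOn_exp_neg_mul_of_abs_le_one_add_pow (hCkcont k) (K := |Bj| * (1 + Aj)) (n := mj) ?_ hν
    intro t ht
    have hs := (hGt t).1
    have habs : Summable fun x : ℤ => |G x t| := summable_abs_of_weighted_summable hs
    have hcs : Summable fun x : ℤ => Real.cos (k * (x : ℝ)) * G x t :=
      Summable.of_norm_bounded habs fun x => by
        rw [Real.norm_eq_abs, abs_mul]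
        exact mul_le_of_le_one_left (abs_nonneg _) (Real.abs_cos_le_one _)
    calc |∑' x : ℤ, Real.cos (k * (x : ℝ)) * G x t| ≤ ∑' x : ℤ, |Real.cos (k * (x : ℝ)) * G x t| := by
          have := norm_tsum_le_tsum_norm hcs.norm
          simpa only [Real.norm_eq_abs] using this
      _ ≤ ∑' x : ℤ, (1 + (x : ℝ) ^ 2) * |G x t| := by
          refine Summable.tsum_le_tsum (fun x => ?_) hcs.abs hs
          rw [abs_mul]
          calc |Real.cos (k * (x : ℝ))| * |G x t| ≤ 1 * |G x t| :=
                mul_le_mul_of_nonneg_right (Real.abs_cos_le_one _) (abs_nonneg _)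
            _ ≤ (1 + (x : ℝ) ^ 2) * |G x t| :=
                mul_le_mul_of_nonneg_right (by nlinarith [sq_nonneg (x : ℝ)]) (abs_nonneg _)
      _ ≤ |Bj| * (1 + Aj) * (1 + |t|) ^ mj := (hGt t).2
      _ = |Bj| * (1 + Aj) * (1 + t) ^ mj := by rw [abs_of_nonneg ht]
  -- (1)
  have h1 : ∀ t : ℝ, D.HasAbsConvergentCorrelation μ t := by
    intro t
    refine ⟨fun x => hss.integrable_bondCurrentZ_mul_comp one_le_two hU0 hUm hV2 (hP.2 t) x 0, ?_⟩
    have hs : Summable fun x : ℤ => |G x t| := summable_abs_of_weighted_summable (hGt t).1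
    refine hs.congr fun x => ?_
    rw [hGd]
  -- (2)
  have h2 : ∀ ν : ℝ, 0 < ν → IntegrableOn (fun t : ℝ => Real.exp (-(ν * t)) * D.currentCorrelation μ t) (Ioi 0) := by
    intro ν hν
    have e : (fun t : ℝ => Real.exp (-(ν * t)) * D.currentCorrelation μ t) =
        fun t : ℝ => Real.exp (-(ν * t)) * ∑' x : ℤ, Real.cos (0 * (x : ℝ)) * G x t := by
      funext t; simp only [hCG t, zero_mul, Real.cos_zero, one_mul]
    rw [e]
    exact h10 ν hν 0
  -- (12)
  have h12 : ∀ ν : ℝ, 0 < ν → ∫ t in Ioi (0:ℝ), Real.exp (-(ν * t)) * D.currentCorrelation μ t =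
      ν / 2 * ((∑' x : ℤ, (x : ℝ) ^ 2 * Sb ν x) - ∑' x : ℤ, (x : ℝ) ^ 2 * S x 0) := by
    intro ν hν
    simp only [hCG]
    exact h12' ν hν
  -- (7) from (11) at `k = 0`
  have h7 : ∀ ν : ℝ, 0 < ν → ∑' x : ℤ, Sb ν x = χk 0 := by
    intro ν hν
    have e := h11 ν hν 0
    have hf0 : fh ν 0 = ∑' x : ℤ, Sb ν x := by simp only [hfh, zero_mul, Real.cos_zero, one_mul]
    rw [Real.cos_zero, hf0] at e
    have hz : (2 - 2 * (1 : ℝ)) * Gh ν 0 / ν = 0 := by ring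
    linarith
  -- (9) Parseval at zero from (4)
  have h9 : ∀ ν : ℝ, 0 < ν → ∫ k in (-Real.pi)..Real.pi, fh ν k = 2 * Real.pi * Sb ν 0 := by
    intro ν hν
    simp only [hfh]
    exact integral_tsum_cos_mul_eq (Sb ν) (hSbabs ν hν)
  exact ⟨h1, h2, h3, h4, h5', h6', h7, h8, h9, h10, h11, h12⟩


end Summit.AtomisticToContinuum.FouriersLaw.Theorems.FibreCalculusSketch

end
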